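import Mathlib
import Literature.NumberTheory.Automorphic.BLZPeriodCocycleCollar

/-!
# Tower graft line — THE ARGUMENT PRINCIPLE FOR POLYNOMIALS ON A CIRCLE (machinery for T1 via Rouché)

Mechanism file for the line `Cruxes/WeakLifting/Lines/tower_graft.lean` (crux `WeakLifting` = stmt-ValiantsHypothesis-19561,
memo `HOME/val-sym-lift-p1/g20/memo/T1-CORNER-liftp1g20.md` §5: T1 «log-slope localisation» in general = Rouché on cluster discs).
NO stub is claimed.  FIRST POLYNOMIAL ARGUMENT PRINCIPLE / ROUCHÉ-ON-A-DISC IN THIS TREE (desk R2791: de-dup search of Mathlib and the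
tree found only the ingredients — `circleIntegral.integral_sub_inv_of_mem_ball`, Cauchy–Goursat
`Complex.circleIntegral_eq_zero_of_differentiable_on_off_countable`, `Polynomial.Splits.eval_derivative_div_eval_of_ne_zero`,
`intervalIntegral.continuous_parametric_intervalIntegral_of_continuous'` — later seats cite this module for both statements).
This file: for a complex polynomial `P ≠ 0` with no root on the circle `|τ − c| = R` (`R > 0`),
`∮_{C(c,R)} P′/P = 2πi · #{roots of P in the open disc, with multiplicity}` (`circleIntegral_logDeriv_polynomial`), from
`P′/P = Σ_{z ∈ roots} (τ − z)⁻¹` (Mathlib `Polynomial.Splits.eval_derivative_div_eval_of_ne_zero`), `∮ (τ − z)⁻¹ = 2πi` for `z` inside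
(`circleIntegral.integral_sub_inv_of_mem_ball`) and `= 0` for `z` outside (Cauchy–Goursat; the tree's
`Literature.NumberTheory.Automorphic.circleIntegral_sub_inv_of_not_mem_closedBall`, imported); and ROUCHÉ FOR POLYNOMIALS ON A DISC
(`card_roots_filter_ball_eq_of_norm_lt`): if `‖Q‖ < ‖P‖` on the circle then `P + Q` and `P` have equally many roots in the open disc —
the λ-homotopy `P + λQ` keeps roots off the circle, the circle integral of its logarithmic derivative is continuous in `λ` and
integer-valued, hence constant (intermediate value theorem).
HONEST FRAMING: classical complex analysis (folklore); nothing on S4/S4b/S5, TowerB, `WeakLifting`, B, 18050 or `VP ≠ VNP`.  Def-free.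
Seat: prover val-sym-lift-p1 g20, `--supports stmt-ValiantsHypothesis-19561`.
-/

-- `Summit.ValiantsHypothesis.ValiantsHypothesis.…` repeats a component by the D-0017 layout
-- (single-conjunct summit), which the `dupNamespace` linter flags; the name is mandated.
set_option linter.dupNamespace false

namespace Summit.ValiantsHypothesis.ValiantsHypothesis.Theorems.KPlusLogSqLaw.TowerGraft

open Polynomial Complex MeasureTheory
open scoped BigOperators Polynomial Real

section ArgumentPrinciple

-- `∮ (τ − w)⁻¹ = 0` for `w` outside the closed disc is the tree's
-- `Literature.NumberTheory.Automorphic.circleIntegral_sub_inv_of_not_mem_closedBall` (BLZPeriodCocycleCollar.lean), reused below.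

/-- the winding indicator of a point off the circle: `∮ (τ − w)⁻¹ = 2πi·[w ∈ ball]`. [folklore] -/
theorem circleIntegral_sub_inv_eq_ite {c w : ℂ} {R : ℝ} (hR : 0 ≤ R) (hw : w ∉ Metric.sphere c R) :
    (∮ z in C(c, R), (z - w)⁻¹) = if dist w c < R then 2 * π * I else 0 := by
  split_ifs with h
  · exact circleIntegral.integral_sub_inv_of_mem_ball (Metric.mem_ball.mpr h)
  · refine Literature.NumberTheory.Automorphic.circleIntegral_sub_inv_of_not_mem_closedBall hR fun hmem => ?_
    rcases (Metric.mem_closedBall.mp hmem).lt_or_eq with hlt | heq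
    · exact h hlt
    · exact hw (Metric.mem_sphere.mpr heq)

/-- circle integral of a multiset sum of `(τ − w)⁻¹`'s. [folklore] -/
theorem circleIntegral_multiset_sum_sub_inv (m : Multiset ℂ) (c : ℂ) {R : ℝ} (hR : 0 ≤ R)
    (hm : ∀ w ∈ m, w ∉ Metric.sphere c R) :
    (∮ z in C(c, R), (m.map fun w => (z - w)⁻¹).sum) = (m.map fun w => ∮ z in C(c, R), (z - w)⁻¹).sum := by
  induction m using Multiset.induction_on with
  | empty => simp [circleIntegral]
  | cons a m ih =>
    have ha : a ∉ Metric.sphere c R := hm a (Multiset.mem_cons_self a m)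
    have hm' : ∀ w ∈ m, w ∉ Metric.sphere c R := fun w hw => hm w (Multiset.mem_cons_of_mem hw)
    have hcont : ∀ w, w ∉ Metric.sphere c R → ContinuousOn (fun z : ℂ => (z - w)⁻¹) (Metric.sphere c |R|) := by
      intro w hw
      refine ContinuousOn.inv₀ (continuousOn_id.sub continuousOn_const) fun z hz => sub_ne_zero.mpr ?_
      rintro rfl
      rw [abs_of_nonneg hR] at hz
      exact hw hz
    have h1 : CircleIntegrable (fun z : ℂ => (z - a)⁻¹) c R := (hcont a ha).circleIntegrable'
    have h2 : CircleIntegrable (fun z : ℂ => (m.map fun w => (z - w)⁻¹).sum) c R := by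
      refine ContinuousOn.circleIntegrable' ?_
      have : (fun z : ℂ => (m.map fun w => (z - w)⁻¹).sum) = fun z => ∑ w ∈ m.toFinset, (m.count w : ℂ) * (z - w)⁻¹ := by
        funext z
        rw [Finset.sum_multiset_map_count]
        simp [nsmul_eq_mul]
      rw [this]
      refine continuousOn_finsetSum _ fun w hw => ?_
      exact continuousOn_const.mul (hcont w (hm' w (Multiset.mem_toFinset.mp hw)))
    simp only [Multiset.map_cons, Multiset.sum_cons]
    rw [← ih hm', ← circleIntegral.integral_add h1 h2]

/-- indicator sums count: `Σ_{w ∈ m} [p w] = #(m.filter p)`. [folklore] -/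
theorem multiset_sum_map_ite_eq_card_filter (m : Multiset ℂ) (p : ℂ → Prop) [DecidablePred p] :
    (m.map fun w => if p w then (1 : ℂ) else 0).sum = (Multiset.card (m.filter p) : ℂ) := by
  induction m using Multiset.induction_on with
  | empty => simp
  | cons a m ih =>
    rw [Multiset.map_cons, Multiset.sum_cons, ih, Multiset.filter_cons]
    split_ifs with h
    · simp [add_comm]
    · simp

/-- **ARGUMENT PRINCIPLE FOR POLYNOMIALS.**  For a complex polynomial `P ≠ 0` with no root on the circle `|τ − c| = R`, `R ≥ 0`:
`∮_{C(c,R)} P′(τ)/P(τ) dτ = 2πi · #{roots of P with |z − c| < R}` (counted with multiplicity). [folklore] -/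
theorem circleIntegral_logDeriv_polynomial (P : ℂ[X]) (hP : P ≠ 0) (c : ℂ) {R : ℝ} (hR : 0 ≤ R)
    (hroots : ∀ z ∈ P.roots, z ∉ Metric.sphere c R) :
    (∮ τ in C(c, R), P.derivative.eval τ / P.eval τ) =
      2 * π * I * (Multiset.card (P.roots.filter fun z => dist z c < R) : ℂ) := by
  have hsplit : P.Splits := IsAlgClosed.splits P
  -- on the circle, `P ≠ 0` and `P′/P = Σ (τ − z)⁻¹`
  have hne : ∀ τ ∈ Metric.sphere c |R|, P.eval τ ≠ 0 := by
    intro τ hτ h0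
    have hmem : τ ∈ P.roots := (Polynomial.mem_roots hP).mpr h0
    rw [abs_of_nonneg hR] at hτ
    exact hroots τ hmem hτ
  have hcongr : (∮ τ in C(c, R), P.derivative.eval τ / P.eval τ) =
      ∮ τ in C(c, R), (P.roots.map fun w => (τ - w)⁻¹).sum := by
    refine circleIntegral.integral_congr hR fun τ hτ => ?_
    have hτ' : τ ∈ Metric.sphere c |R| := by rwa [abs_of_nonneg hR]
    rw [hsplit.eval_derivative_div_eval_of_ne_zero (hne τ hτ')]
    exact congrArg _ (Multiset.map_congr rfl fun w _ => by rw [one_div])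
  rw [hcongr, circleIntegral_multiset_sum_sub_inv P.roots c hR hroots]
  have hterm : (P.roots.map fun w => ∮ z in C(c, R), (z - w)⁻¹) =
      P.roots.map fun w => (2 * π * I) * (if dist w c < R then (1 : ℂ) else 0) := by
    refine Multiset.map_congr rfl fun w hw => ?_
    rw [circleIntegral_sub_inv_eq_ite hR (hroots w hw)]
    split_ifs <;> simp
  rw [hterm, Multiset.sum_map_mul_left, multiset_sum_map_ite_eq_card_filter]

end ArgumentPrinciple

end Summit.ValiantsHypothesis.ValiantsHypothesis.Theorems.KPlusLogSqLaw.TowerGraft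

namespace Summit.ValiantsHypothesis.ValiantsHypothesis.Theorems.KPlusLogSqLaw.TowerGraft

open Polynomial Complex MeasureTheory
open scoped BigOperators Polynomial Real

/-! ## Rouché for polynomials on a disc (λ-homotopy + argument principle) -/

section Rouche

/-- along the homotopy `P + λ·Q`, `0 ≤ λ ≤ 1`, no root reaches the circle when `‖Q‖ < ‖P‖` there. [folklore] -/
theorem eval_homotopy_ne_zero (P Q : ℂ[X]) {c : ℂ} {R : ℝ} {τ : ℂ} (hτ : τ ∈ Metric.sphere c R)
    (hPQ : ∀ τ ∈ Metric.sphere c R, ‖Q.eval τ‖ < ‖P.eval τ‖) {l : ℝ} (hl0 : 0 ≤ l) (hl1 : l ≤ 1) :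
    (P + C (l : ℂ) * Q).eval τ ≠ 0 := by
  intro h0
  rw [eval_add, eval_mul, eval_C] at h0
  have h1 : P.eval τ = -((l : ℂ) * Q.eval τ) := by linear_combination h0
  have h2 : ‖P.eval τ‖ ≤ ‖Q.eval τ‖ := by
    rw [h1, norm_neg, norm_mul, Complex.norm_real, Real.norm_eq_abs, abs_of_nonneg hl0]
    calc l * ‖Q.eval τ‖ ≤ 1 * ‖Q.eval τ‖ := mul_le_mul_of_nonneg_right hl1 (norm_nonneg _)
      _ = ‖Q.eval τ‖ := one_mul _
  exact absurd (hPQ τ hτ) (not_lt.mpr h2)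

/-- **ROUCHÉ FOR POLYNOMIALS ON A DISC.**  If `‖Q(τ)‖ < ‖P(τ)‖` on the circle `|τ − c| = R` (`R > 0`), then `P + Q` and `P` have
the same number of roots (with multiplicity) in the open disc. [folklore] -/
theorem card_roots_filter_ball_eq_of_norm_lt (P Q : ℂ[X]) (c : ℂ) {R : ℝ} (hR : 0 < R)
    (hPQ : ∀ τ ∈ Metric.sphere c R, ‖Q.eval τ‖ < ‖P.eval τ‖) :
    Multiset.card ((P + Q).roots.filter fun z => dist z c < R) =
      Multiset.card (P.roots.filter fun z => dist z c < R) := by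
  -- the homotopy and its non-vanishing on the circle
  set Pl : ℝ → ℂ[X] := fun l => P + C (l : ℂ) * Q with hPl
  have hne : ∀ l : ℝ, 0 ≤ l → l ≤ 1 → ∀ τ ∈ Metric.sphere c R, (Pl l).eval τ ≠ 0 :=
    fun l hl0 hl1 τ hτ => eval_homotopy_ne_zero P Q hτ hPQ hl0 hl1
  have hsome : (c + R : ℂ) ∈ Metric.sphere c R := by
    simp [abs_of_pos hR]
  have hPl0 : ∀ l : ℝ, 0 ≤ l → l ≤ 1 → Pl l ≠ 0 := by
    intro l hl0 hl1 h0
    exact hne l hl0 hl1 _ hsome (by rw [h0, eval_zero])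
  have hroots : ∀ l : ℝ, 0 ≤ l → l ≤ 1 → ∀ z ∈ (Pl l).roots, z ∉ Metric.sphere c R := by
    intro l hl0 hl1 z hz hzs
    exact hne l hl0 hl1 z hzs ((Polynomial.mem_roots (hPl0 l hl0 hl1)).mp hz)
  -- the count as a circle integral
  set N : ℝ → ℕ := fun l => Multiset.card ((Pl l).roots.filter fun z => dist z c < R) with hN
  have hint : ∀ l : ℝ, 0 ≤ l → l ≤ 1 →
      (∮ τ in C(c, R), (Pl l).derivative.eval τ / (Pl l).eval τ) = 2 * π * I * (N l : ℂ) :=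
    fun l hl0 hl1 => circleIntegral_logDeriv_polynomial (Pl l) (hPl0 l hl0 hl1) c hR.le (hroots l hl0 hl1)
  -- continuity of the circle integral in `l ∈ [0,1]`
  have hcont : ContinuousOn (fun l : ℝ => ∮ τ in C(c, R), (Pl l).derivative.eval τ / (Pl l).eval τ) (Set.Icc 0 1) := by
    rw [continuousOn_iff_continuous_restrict]
    have hF : Continuous (Function.uncurry fun (x : Set.Icc (0 : ℝ) 1) (θ : ℝ) =>
        deriv (circleMap c R) θ • ((Pl x.1).derivative.eval (circleMap c R θ) / (Pl x.1).eval (circleMap c R θ))) := by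
      have hγ : Continuous fun p : Set.Icc (0 : ℝ) 1 × ℝ => circleMap c R p.2 :=
        (continuous_circleMap c R).comp continuous_snd
      have hl : Continuous fun p : Set.Icc (0 : ℝ) 1 × ℝ => ((p.1 : ℝ) : ℂ) :=
        Complex.continuous_ofReal.comp (continuous_subtype_val.comp continuous_fst)
      have hnum : Continuous fun p : Set.Icc (0 : ℝ) 1 × ℝ =>
          (Pl p.1.1).derivative.eval (circleMap c R p.2) := by
        have : (fun p : Set.Icc (0 : ℝ) 1 × ℝ => (Pl p.1.1).derivative.eval (circleMap c R p.2)) =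
            fun p => P.derivative.eval (circleMap c R p.2) + ((p.1 : ℝ) : ℂ) * Q.derivative.eval (circleMap c R p.2) := by
          funext p; simp [hPl, derivative_add, derivative_mul, eval_add, eval_mul]
        rw [this]
        exact ((P.derivative.continuous).comp hγ).add (hl.mul ((Q.derivative.continuous).comp hγ))
      have hden : Continuous fun p : Set.Icc (0 : ℝ) 1 × ℝ => (Pl p.1.1).eval (circleMap c R p.2) := by
        have : (fun p : Set.Icc (0 : ℝ) 1 × ℝ => (Pl p.1.1).eval (circleMap c R p.2)) =
            fun p => P.eval (circleMap c R p.2) + ((p.1 : ℝ) : ℂ) * Q.eval (circleMap c R p.2) := by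
          funext p; simp [hPl, eval_add, eval_mul]
        rw [this]
        exact ((P.continuous).comp hγ).add (hl.mul ((Q.continuous).comp hγ))
      have hden0 : ∀ p : Set.Icc (0 : ℝ) 1 × ℝ, (Pl p.1.1).eval (circleMap c R p.2) ≠ 0 :=
        fun p => hne p.1.1 p.1.2.1 p.1.2.2 _ (circleMap_mem_sphere c hR.le p.2)
      have hder : Continuous fun p : Set.Icc (0 : ℝ) 1 × ℝ => deriv (circleMap c R) p.2 := by
        have : (fun p : Set.Icc (0 : ℝ) 1 × ℝ => deriv (circleMap c R) p.2) = fun p => circleMap 0 R p.2 * I := by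
          funext p; rw [deriv_circleMap]
        rw [this]
        exact ((continuous_circleMap 0 R).comp continuous_snd).mul continuous_const
      exact hder.smul (hnum.div hden hden0)
    have := intervalIntegral.continuous_parametric_intervalIntegral_of_continuous' (μ := volume) hF 0 (2 * π)
    exact this
  -- the normalised difference is a continuous integer-valued function on `[0,1]` vanishing at `0`
  set φ : ℝ → ℝ := fun l => ‖(∮ τ in C(c, R), (Pl l).derivative.eval τ / (Pl l).eval τ) -
      (∮ τ in C(c, R), (Pl 0).derivative.eval τ / (Pl 0).eval τ)‖ / (2 * π) with hφ
  have hφcont : ContinuousOn φ (Set.Icc 0 1) := by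
    refine ContinuousOn.div_const (ContinuousOn.norm (hcont.sub continuousOn_const)) _
  have hφval : ∀ l : ℝ, 0 ≤ l → l ≤ 1 → φ l = |((N l : ℝ) - N 0)| := by
    intro l hl0 hl1
    simp only [hφ]
    rw [hint l hl0 hl1, hint 0 le_rfl zero_le_one, ← mul_sub, norm_mul]
    have h2pi : ‖(2 * π * I : ℂ)‖ = 2 * π := by
      simp [Complex.norm_real, Real.norm_eq_abs, abs_of_pos Real.pi_pos]
    rw [h2pi, ← Complex.ofReal_natCast, ← Complex.ofReal_natCast, ← Complex.ofReal_sub, Complex.norm_real,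
      Real.norm_eq_abs]
    field_simp
  have hφint : ∀ l : ℝ, 0 ≤ l → l ≤ 1 → ∃ k : ℤ, φ l = k := by
    intro l hl0 hl1
    refine ⟨|((N l : ℤ) - N 0)|, ?_⟩
    rw [hφval l hl0 hl1]
    push_cast
    ring_nf
  have hφ0 : φ 0 = 0 := by rw [hφval 0 le_rfl zero_le_one]; simp
  -- if `N 1 ≠ N 0` then `φ 1 ≥ 1` and the intermediate value `1/2` is taken: contradiction
  by_contra hneq
  have hφ1 : 1 ≤ φ 1 := by
    rw [hφval 1 zero_le_one le_rfl]
    have hz : ((N 1 : ℤ) - N 0) ≠ 0 := by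
      intro h; apply hneq
      have h01 : (N 1 : ℤ) = N 0 := by linarith
      have h1 : N 1 = N 0 := by exact_mod_cast h01
      simp only [hN, hPl] at h1
      simpa using h1
    have h2 : (1 : ℤ) ≤ |((N 1 : ℤ) - N 0)| := Int.one_le_abs hz
    have h3 : ((1 : ℤ) : ℝ) ≤ ((|((N 1 : ℤ) - N 0)| : ℤ) : ℝ) := Int.cast_le.mpr h2
    rw [Int.cast_abs] at h3
    push_cast at h3
    exact h3
  obtain ⟨l, hl, hlφ⟩ : ∃ l ∈ Set.Icc (0 : ℝ) 1, φ l = 1 / 2 := by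
    have hmem : (1 / 2 : ℝ) ∈ Set.Icc (φ 0) (φ 1) := by rw [hφ0]; constructor <;> linarith
    exact intermediate_value_Icc zero_le_one hφcont hmem
  obtain ⟨k, hk⟩ := hφint l hl.1 hl.2
  rw [hk] at hlφ
  have h2 : (2 * k : ℤ) = 1 := by
    have : (2 * k : ℝ) = 1 := by linarith
    exact_mod_cast this
  omega

end Rouche

end Summit.ValiantsHypothesis.ValiantsHypothesis.Theorems.KPlusLogSqLaw.TowerGraft
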